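import Summits.KontsevichZagierPeriods.KontsevichZagierPeriods.Theorems.UnfoldedStokesStokesGenerationStubPolylogArgHomotopy3
import Summits.KontsevichZagierPeriods.KontsevichZagierPeriods.Theorems.UnfoldedStokesStokesGenerationStubLogPolylogProductHomotopy
import Summits.KontsevichZagierPeriods.KontsevichZagierPeriods.Theorems.UnfoldedStokesStokesGenerationStubLogTripleProductHomotopy
import Summits.KontsevichZagierPeriods.KontsevichZagierPeriods.Theorems.UnfoldedStokesStokesGenerationFibrewiseRungAngSwap

/-!
# `StokesGeneration` (stmt-KontsevichZagierPeriods-3586), line `fibrewise_stokes` — rung 26, part A: the seven homotopy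
# elements of the trilogarithm

Crux `Summit.KontsevichZagierPeriods.KontsevichZagierPeriods.Theses.UnfoldedStokes.StokesGeneration`; residual stub S2
(`FibStokesDecomposable`, `Theorems/UnfoldedStokesDefs.lean`). Rung 26 proves that the weight-three combination
`G(x) = Li₃(x) + Li₃(1−x) + Li₃(−x/(1−x)) − log(1−x)·(Li₂(x) + Li₂(1−x)) − ½log x·log²(1−x) − ⅙log³(1−x)` (value `ζ(3)` on
`(0,1)`: Landen's trilogarithm identity with Euler's reflection formula substituted for `π²/6`) is CONSTANT modulo
fibrewise-Stokes decomposability along real algebraic `x ∈ (0,1)`. This file instantiates, along the affine path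
`x(v) = x₁ + (x₂−x₁)v` in the fourth cube coordinate `v = x 3` of `[0,1]⁴` (`s,t,u = x 0, x 1, x 2`), the generic homotopy
tools of rung 24 for the seven terms of the cube integrand of `G`: the weight-three argument homotopy
(`stub_polylogArgHomotopy3`) for the three `Li₃` terms, the `log × Li₂` product homotopy (`stub_logPolylogProductHomotopy`) for
the two mixed terms, and the triple log-product homotopy (`stub_logTripleProductHomotopy`) for `½log x log²(1−x)` and
`⅙log³(1−x)`. Each instance trades `term|_{v=1} − term|_{v=0}` for an explicit one-weight-lower LEFTOVER with the silent
parameter `v`; part B shows that the leftovers add up to `x′/(x(1−x))` times Landen's identity at `a = x(v)` (rung 25), part C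
assembles. Transcendence-free and value-free.

References: L. Lewin, *Polylogarithms and associated functions* (1981), (6.10); D. Zagier, *The dilogarithm function* (2007),
§I.2; M. Kontsevich, D. Zagier, *Periods* (2001), §1.2.
-/

noncomputable section

-- `Summit.KontsevichZagierPeriods.KontsevichZagierPeriods.…` is the tree's mandated layout (single-conjunct summit).
set_option linter.dupNamespace false

namespace Summit.KontsevichZagierPeriods.KontsevichZagierPeriods.Cruxes.StokesGeneration.FibrewiseStokes

open MeasureTheory Set
open Literature.NumberTheory.Transcendental
open Literature.NumberTheory.Transcendental.KZ
open Literature.ModelTheory.ExponentialFields (IsSemialgebraic)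

/-! ## Part A — shared path data for `x(v) = x₁ + (x₂ − x₁)v` -/

section PathData

variable {x₁ x₂ : ℝ}

/-- The affine path `x(v) = x₁ + (x₂−x₁)v` stays in `(0,1)` for `v ∈ [0,1]` when its ends do. [folklore] -/
theorem trilog_path_mem (h₁0 : 0 < x₁) (h₁1 : x₁ < 1) (h₂0 : 0 < x₂) (h₂1 : x₂ < 1) :
    ∀ v ∈ Set.Icc (0:ℝ) 1, 0 < x₁ + (x₂ - x₁) * v ∧ x₁ + (x₂ - x₁) * v < 1 := by
  intro v hv
  rcases le_or_gt 0 (x₂ - x₁) with hd0 | hd0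
  · constructor <;> nlinarith [hv.1, hv.2]
  · constructor <;> nlinarith [hv.1, hv.2]

/-- The path read along a coordinate of a closed cube is `ℚ`-semialgebraic. [folklore] -/
theorem trilog_sa_path {n : ℕ} (h₁ : IsAlgebraic ℚ x₁) (h₂ : IsAlgebraic ℚ x₂) (i : Fin n) :
    IsSemialgebraicFunOn ℚ (Set.pi Set.univ (fun _ : Fin n => Set.Icc (0:ℝ) 1)) (fun z => x₁ + (x₂ - x₁) * z i) := by
  have hS : IsSemialgebraic ℚ (Set.pi Set.univ (fun _ : Fin n => Set.Icc (0:ℝ) 1)) := by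
    rw [← cube_eq_pi]; exact isSemialgebraic_cube
  exact (isSemialgebraicFunOn_const_of_isAlgebraic hS h₁).fun_add
    ((isSemialgebraicFunOn_const_of_isAlgebraic hS (h₂.sub h₁)).fun_mul (isSemialgebraicFunOn_apply hS i))

/-- Positivity of `1 − x(z_j)·p` on the cube for any product `p ∈ [0,1]` of coordinates. [folklore] -/
theorem trilog_den_pos (h₁0 : 0 < x₁) (h₁1 : x₁ < 1) (h₂0 : 0 < x₂) (h₂1 : x₂ < 1)
    {v p : ℝ} (hv : v ∈ Set.Icc (0:ℝ) 1) (hp1 : p ≤ 1) :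
    0 < 1 - (x₁ + (x₂ - x₁) * v) * p ∧ 0 < 1 - (1 - (x₁ + (x₂ - x₁) * v)) * p := by
  have hx := trilog_path_mem h₁0 h₁1 h₂0 h₂1 v hv
  constructor
  · nlinarith [hx.1, hp1]
  · nlinarith [hx.2, hp1]

/-- Products of cube coordinates lie in `[0,1]`. [folklore] -/
theorem trilog_prod_mem {n : ℕ} {z : Fin n → ℝ} (hz : z ∈ Set.pi Set.univ (fun _ : Fin n => Set.Icc (0:ℝ) 1))
    (i j : Fin n) : 0 ≤ z i * z j ∧ z i * z j ≤ 1 := by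
  have hi := (Set.mem_univ_pi.mp hz) i; have hj := (Set.mem_univ_pi.mp hz) j
  exact ⟨mul_nonneg hi.1 hj.1, by nlinarith [hi.1, hi.2, hj.1, hj.2]⟩

end PathData

/-! ## Part A — the seven tool instances on `[0,1]⁴` (`s = x 0`, `t = x 1`, `u = x 2`, `v = x 3`) -/

/-- (A1) `Li₃(x(v))`: the weight-three argument homotopy (G3) along the affine path. [cite: Zagier2007Dilogarithm, §I.2] -/
theorem trilog_termLi3 (x₁ x₂ : ℝ) (h₁ : IsAlgebraic ℚ x₁) (h₂ : IsAlgebraic ℚ x₂)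
    (h₁0 : 0 < x₁) (h₁1 : x₁ < 1) (h₂0 : 0 < x₂) (h₂1 : x₂ < 1) :
    FibStokesDecomposable 4 (fun x => (x₂ - x₁) / (1 - (x₁ + (x₂ - x₁) * x 3) * x 0 * x 1) -
      ((x₁ + (x₂ - x₁) * 1) / (1 - (x₁ + (x₂ - x₁) * 1) * x 0 * x 1 * x 2) -
        (x₁ + (x₂ - x₁) * 0) / (1 - (x₁ + (x₂ - x₁) * 0) * x 0 * x 1 * x 2))) := by
  have hS1 : IsSemialgebraic ℚ (Set.pi Set.univ (fun _ : Fin 1 => Set.Icc (0:ℝ) 1)) := by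
    rw [← cube_eq_pi]; exact isSemialgebraic_cube
  exact stub_polylogArgHomotopy3 (fun v => x₁ + (x₂ - x₁) * v) (fun _ => x₂ - x₁) (trilog_sa_path h₁ h₂ 0)
    (isSemialgebraicFunOn_const_of_isAlgebraic hS1 (h₂.sub h₁)) (by fun_prop) continuousOn_const
    (fun v _ => (((hasDerivAt_id' v).const_mul (x₂ - x₁)).const_add x₁).congr_deriv (by ring))
    (fun v hv => (trilog_path_mem h₁0 h₁1 h₂0 h₂1 v hv).2)

/-- (A2) `Li₃(1 − x(v))`: G3 along the path `1 − x(v)`. [cite: Zagier2007Dilogarithm, §I.2] -/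
theorem trilog_termLi3' (x₁ x₂ : ℝ) (h₁ : IsAlgebraic ℚ x₁) (h₂ : IsAlgebraic ℚ x₂)
    (h₁0 : 0 < x₁) (h₁1 : x₁ < 1) (h₂0 : 0 < x₂) (h₂1 : x₂ < 1) :
    FibStokesDecomposable 4 (fun x => -(x₂ - x₁) / (1 - (1 - (x₁ + (x₂ - x₁) * x 3)) * x 0 * x 1) -
      ((1 - (x₁ + (x₂ - x₁) * 1)) / (1 - (1 - (x₁ + (x₂ - x₁) * 1)) * x 0 * x 1 * x 2) -
        (1 - (x₁ + (x₂ - x₁) * 0)) / (1 - (1 - (x₁ + (x₂ - x₁) * 0)) * x 0 * x 1 * x 2))) := by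
  have hS1 : IsSemialgebraic ℚ (Set.pi Set.univ (fun _ : Fin 1 => Set.Icc (0:ℝ) 1)) := by
    rw [← cube_eq_pi]; exact isSemialgebraic_cube
  exact stub_polylogArgHomotopy3 (fun v => 1 - (x₁ + (x₂ - x₁) * v)) (fun _ => -(x₂ - x₁))
    ((isSemialgebraicFunOn_const_of_isAlgebraic hS1 isAlgebraic_one).fun_sub (trilog_sa_path h₁ h₂ 0))
    (isSemialgebraicFunOn_const_of_isAlgebraic hS1 (h₂.sub h₁)).fun_neg (by fun_prop) continuousOn_const
    (fun v _ => ((((hasDerivAt_id' v).const_mul (x₂ - x₁)).const_add x₁).const_sub 1).congr_deriv (by ring))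
    (fun v hv => by linarith [(trilog_path_mem h₁0 h₁1 h₂0 h₂1 v hv).1])

/-- (A3) `Li₃(−x/(1−x))` along the path: G3 with `w = −x(v)/(1−x(v))`, `w′ = −(x₂−x₁)/(1−x(v))²`.
[cite: Zagier2007Dilogarithm, §I.2] -/
theorem trilog_termLi3w (x₁ x₂ : ℝ) (h₁ : IsAlgebraic ℚ x₁) (h₂ : IsAlgebraic ℚ x₂)
    (h₁0 : 0 < x₁) (h₁1 : x₁ < 1) (h₂0 : 0 < x₂) (h₂1 : x₂ < 1) :
    FibStokesDecomposable 4 (fun x =>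
      (-(x₂ - x₁) / (1 - (x₁ + (x₂ - x₁) * x 3)) ^ 2) /
          (1 - (-(x₁ + (x₂ - x₁) * x 3) / (1 - (x₁ + (x₂ - x₁) * x 3))) * x 0 * x 1) -
      ((-(x₁ + (x₂ - x₁) * 1) / (1 - (x₁ + (x₂ - x₁) * 1))) /
            (1 - (-(x₁ + (x₂ - x₁) * 1) / (1 - (x₁ + (x₂ - x₁) * 1))) * x 0 * x 1 * x 2) -
        (-(x₁ + (x₂ - x₁) * 0) / (1 - (x₁ + (x₂ - x₁) * 0))) /
            (1 - (-(x₁ + (x₂ - x₁) * 0) / (1 - (x₁ + (x₂ - x₁) * 0))) * x 0 * x 1 * x 2))) := by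
  have hS1 : IsSemialgebraic ℚ (Set.pi Set.univ (fun _ : Fin 1 => Set.Icc (0:ℝ) 1)) := by
    rw [← cube_eq_pi]; exact isSemialgebraic_cube
  have hI : ∀ {z : Fin 1 → ℝ}, z ∈ Set.pi Set.univ (fun _ : Fin 1 => Set.Icc (0:ℝ) 1) → z 0 ∈ Set.Icc (0:ℝ) 1 :=
    fun hz => (Set.mem_univ_pi.mp hz) 0
  have hne : ∀ z ∈ Set.pi Set.univ (fun _ : Fin 1 => Set.Icc (0:ℝ) 1), 1 - (x₁ + (x₂ - x₁) * z 0) ≠ 0 :=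
    fun z hz => by have := (trilog_path_mem h₁0 h₁1 h₂0 h₂1 _ (hI hz)).2; linarith
  have sx := trilog_sa_path (n := 1) h₁ h₂ 0
  have s1x := (isSemialgebraicFunOn_const_of_isAlgebraic hS1 isAlgebraic_one).fun_sub sx
  refine stub_polylogArgHomotopy3 (fun v => -(x₁ + (x₂ - x₁) * v) / (1 - (x₁ + (x₂ - x₁) * v)))
    (fun v => -(x₂ - x₁) / (1 - (x₁ + (x₂ - x₁) * v)) ^ 2)
    (sx.fun_neg.div s1x hne)
    ((isSemialgebraicFunOn_const_of_isAlgebraic hS1 (h₂.sub h₁)).fun_neg.div (s1x.fun_pow 2)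
      fun z hz => pow_ne_zero 2 (hne z hz))
    (ContinuousOn.div (by fun_prop) (by fun_prop) fun v hv => ?_)
    (ContinuousOn.div (by fun_prop) (by fun_prop) fun v hv => pow_ne_zero 2 ?_) (fun v hv => ?_) (fun v hv => ?_)
  · have := (trilog_path_mem h₁0 h₁1 h₂0 h₂1 v hv).2; linarith
  · have := (trilog_path_mem h₁0 h₁1 h₂0 h₂1 v hv).2; linarith
  · have hx1 : 1 - (x₁ + (x₂ - x₁) * v) ≠ 0 := by
      have := (trilog_path_mem h₁0 h₁1 h₂0 h₂1 v (Set.Ioo_subset_Icc_self hv)).2; linarith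
    have hx := ((hasDerivAt_id' v).const_mul (x₂ - x₁)).const_add x₁
    exact (hx.fun_neg.div (hx.const_sub 1) hx1).congr_deriv (by field_simp; ring)
  · have hx := trilog_path_mem h₁0 h₁1 h₂0 h₂1 v hv
    have hx1 : 0 < 1 - (x₁ + (x₂ - x₁) * v) := by linarith [hx.2]
    rw [div_lt_one hx1]; linarith [hx.1]

/-- (A4/A5 data) the `log(1−x(v))` family `ℓ(u,v) = −x/(1−xu)` and the `Li₂(w(v))` families, packaged once: PH2 for
`−ℓ(u,v)·T_w(s,t,v)` with `w = x(v)` (`ε = 1, c = 0`) or `w = 1 − x(v)` (`ε = −1, c = 1`), i.e. `w = c + εx`, `w′ = ε(x₂−x₁)`.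
[cite: Zagier2007Dilogarithm, §I.2] -/
theorem trilog_termLogLi2 (x₁ x₂ : ℝ) (h₁ : IsAlgebraic ℚ x₁) (h₂ : IsAlgebraic ℚ x₂)
    (h₁0 : 0 < x₁) (h₁1 : x₁ < 1) (h₂0 : 0 < x₂) (h₂1 : x₂ < 1) (ε c : ℝ) (hεc : (ε = 1 ∧ c = 0) ∨ (ε = -1 ∧ c = 1)) :
    FibStokesDecomposable 4 (fun x =>
      (-(x₂ - x₁) * 1 / (1 - (x₁ + (x₂ - x₁) * x 3) * 1)) *
            ((c + ε * (x₁ + (x₂ - x₁) * x 3)) / (1 - (c + ε * (x₁ + (x₂ - x₁) * x 3)) * x 0 * x 1)) +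
          (-(x₁ + (x₂ - x₁) * x 3) / (1 - (x₁ + (x₂ - x₁) * x 3) * x 2)) *
            (ε * (x₂ - x₁) * 1 / (1 - (c + ε * (x₁ + (x₂ - x₁) * x 3)) * x 0 * 1)) -
        ((-(x₁ + (x₂ - x₁) * 1) / (1 - (x₁ + (x₂ - x₁) * 1) * x 2)) *
            ((c + ε * (x₁ + (x₂ - x₁) * 1)) / (1 - (c + ε * (x₁ + (x₂ - x₁) * 1)) * x 0 * x 1)) -
          (-(x₁ + (x₂ - x₁) * 0) / (1 - (x₁ + (x₂ - x₁) * 0) * x 2)) *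
            ((c + ε * (x₁ + (x₂ - x₁) * 0)) / (1 - (c + ε * (x₁ + (x₂ - x₁) * 0)) * x 0 * x 1)))) := by
  have hS2 : IsSemialgebraic ℚ (Set.pi Set.univ (fun _ : Fin 2 => Set.Icc (0:ℝ) 1)) := by
    rw [← cube_eq_pi]; exact isSemialgebraic_cube
  have hS3 : IsSemialgebraic ℚ (Set.pi Set.univ (fun _ : Fin 3 => Set.Icc (0:ℝ) 1)) := by
    rw [← cube_eq_pi]; exact isSemialgebraic_cube
  have hm2 : ∀ {z : Fin 2 → ℝ}, z ∈ Set.pi Set.univ (fun _ : Fin 2 => Set.Icc (0:ℝ) 1) → ∀ i, z i ∈ Set.Icc (0:ℝ) 1 :=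
    fun hz i => (Set.mem_univ_pi.mp hz) i
  have hm3 : ∀ {z : Fin 3 → ℝ}, z ∈ Set.pi Set.univ (fun _ : Fin 3 => Set.Icc (0:ℝ) 1) → ∀ i, z i ∈ Set.Icc (0:ℝ) 1 :=
    fun hz i => (Set.mem_univ_pi.mp hz) i
  have hεA : IsAlgebraic ℚ ε := by
    rcases hεc with ⟨rfl, -⟩ | ⟨rfl, -⟩
    · exact isAlgebraic_one
    · exact isAlgebraic_one.neg
  have hcA : IsAlgebraic ℚ c := by
    rcases hεc with ⟨-, rfl⟩ | ⟨-, rfl⟩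
    · exact isAlgebraic_zero
    · exact isAlgebraic_one
  have hdA : IsAlgebraic ℚ (x₂ - x₁) := h₂.sub h₁
  -- the path of arguments `w = c + εx` stays in `(0,1)`
  have hw : ∀ v ∈ Set.Icc (0:ℝ) 1, 0 < c + ε * (x₁ + (x₂ - x₁) * v) ∧ c + ε * (x₁ + (x₂ - x₁) * v) < 1 := by
    intro v hv
    have hx := trilog_path_mem h₁0 h₁1 h₂0 h₂1 v hv
    rcases hεc with ⟨rfl, rfl⟩ | ⟨rfl, rfl⟩
    · constructor <;> linarith [hx.1, hx.2]
    · constructor <;> linarith [hx.1, hx.2]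
  -- denominators
  have dℓ : ∀ z ∈ Set.pi Set.univ (fun _ : Fin 2 => Set.Icc (0:ℝ) 1), 0 < 1 - (x₁ + (x₂ - x₁) * z 1) * z 0 :=
    fun z hz => (trilog_den_pos h₁0 h₁1 h₂0 h₂1 (hm2 hz 1) (hm2 hz 0).2).1
  have dT : ∀ z ∈ Set.pi Set.univ (fun _ : Fin 3 => Set.Icc (0:ℝ) 1),
      0 < 1 - (c + ε * (x₁ + (x₂ - x₁) * z 2)) * z 0 * z 1 := by
    intro z hz
    have hp := trilog_prod_mem hz 0 1
    have hwz := hw (z 2) (hm3 hz 2)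
    rw [mul_assoc]; nlinarith [mul_nonneg hwz.1.le hp.1]
  -- semialgebraic atoms
  have y : ∀ i, IsSemialgebraicFunOn ℚ (Set.pi Set.univ (fun _ : Fin 2 => Set.Icc (0:ℝ) 1)) (fun z => z i) :=
    fun i => isSemialgebraicFunOn_apply hS2 i
  have w3 : ∀ i, IsSemialgebraicFunOn ℚ (Set.pi Set.univ (fun _ : Fin 3 => Set.Icc (0:ℝ) 1)) (fun z => z i) :=
    fun i => isSemialgebraicFunOn_apply hS3 i
  have c2 : ∀ {t : ℝ}, IsAlgebraic ℚ t → IsSemialgebraicFunOn ℚ (Set.pi Set.univ (fun _ : Fin 2 => Set.Icc (0:ℝ) 1)) (fun _ => t) :=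
    fun ht => isSemialgebraicFunOn_const_of_isAlgebraic hS2 ht
  have c3 : ∀ {t : ℝ}, IsAlgebraic ℚ t → IsSemialgebraicFunOn ℚ (Set.pi Set.univ (fun _ : Fin 3 => Set.Icc (0:ℝ) 1)) (fun _ => t) :=
    fun ht => isSemialgebraicFunOn_const_of_isAlgebraic hS3 ht
  have sx2 := trilog_sa_path (n := 2) h₁ h₂ 1
  have sx3 := trilog_sa_path (n := 3) h₁ h₂ 2
  have sw3 : IsSemialgebraicFunOn ℚ (Set.pi Set.univ (fun _ : Fin 3 => Set.Icc (0:ℝ) 1))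
      (fun z => c + ε * (x₁ + (x₂ - x₁) * z 2)) := (c3 hcA).fun_add ((c3 hεA).fun_mul sx3)
  have sDℓ : IsSemialgebraicFunOn ℚ (Set.pi Set.univ (fun _ : Fin 2 => Set.Icc (0:ℝ) 1))
      (fun z => 1 - (x₁ + (x₂ - x₁) * z 1) * z 0) := (c2 isAlgebraic_one).fun_sub (sx2.fun_mul (y 0))
  have sDT : IsSemialgebraicFunOn ℚ (Set.pi Set.univ (fun _ : Fin 3 => Set.Icc (0:ℝ) 1))
      (fun z => 1 - (c + ε * (x₁ + (x₂ - x₁) * z 2)) * z 0 * z 1) :=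
    (c3 isAlgebraic_one).fun_sub ((sw3.fun_mul (w3 0)).fun_mul (w3 1))
  refine stub_logPolylogProductHomotopy
    (fun u v => -(x₁ + (x₂ - x₁) * v) / (1 - (x₁ + (x₂ - x₁) * v) * u))
    (fun u v => -(x₂ - x₁) / (1 - (x₁ + (x₂ - x₁) * v) * u) ^ 2)
    (fun u v => -(x₂ - x₁) * u / (1 - (x₁ + (x₂ - x₁) * v) * u))
    (fun s t v => (c + ε * (x₁ + (x₂ - x₁) * v)) / (1 - (c + ε * (x₁ + (x₂ - x₁) * v)) * s * t))
    (fun s t v => ε * (x₂ - x₁) / (1 - (c + ε * (x₁ + (x₂ - x₁) * v)) * s * t) ^ 2)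
    (fun s t v => ε * (x₂ - x₁) * t / (1 - (c + ε * (x₁ + (x₂ - x₁) * v)) * s * t))
    (sx2.fun_neg.div sDℓ fun z hz => (dℓ z hz).ne')
    ((c2 hdA).fun_neg.div (sDℓ.fun_pow 2) fun z hz => pow_ne_zero 2 (dℓ z hz).ne')
    ((((c2 hdA).fun_neg).fun_mul (y 0)).div sDℓ fun z hz => (dℓ z hz).ne')
    (sw3.div sDT fun z hz => (dT z hz).ne')
    (((c3 hεA).fun_mul (c3 hdA)).div (sDT.fun_pow 2) fun z hz => pow_ne_zero 2 (dT z hz).ne')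
    ((((c3 hεA).fun_mul (c3 hdA)).fun_mul (w3 1)).div sDT fun z hz => (dT z hz).ne')
    (ContinuousOn.div (by fun_prop) (by fun_prop) fun z hz => (dℓ z hz).ne')
    (ContinuousOn.div (by fun_prop) (by fun_prop) fun z hz => pow_ne_zero 2 (dℓ z hz).ne')
    (ContinuousOn.div (by fun_prop) (by fun_prop) fun z hz => (dℓ z hz).ne')
    (ContinuousOn.div (by fun_prop) (by fun_prop) fun z hz => (dT z hz).ne')
    (ContinuousOn.div (by fun_prop) (by fun_prop) fun z hz => pow_ne_zero 2 (dT z hz).ne')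
    (ContinuousOn.div (by fun_prop) (by fun_prop) fun z hz => (dT z hz).ne')
    (fun u hu v hv => ?_) (fun v hv u hu => ?_) (fun v _ => by simp) (fun s hs t ht v hv => ?_)
    (fun s hs v hv t ht => ?_) (fun s _ v _ => by simp)
  · have hne : 1 - (x₁ + (x₂ - x₁) * v) * u ≠ 0 := by
      have := dℓ ![u, v] (Set.mem_univ_pi.mpr (Fin.forall_fin_two.mpr ⟨hu, Set.Ioo_subset_Icc_self hv⟩))
      simpa using this.ne'
    have hx := ((hasDerivAt_id' v).const_mul (x₂ - x₁)).const_add x₁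
    exact (hx.fun_neg.div ((hx.mul_const u).const_sub 1) hne).congr_deriv (by field_simp; ring)
  · have hne : 1 - (x₁ + (x₂ - x₁) * v) * u ≠ 0 := by
      have := dℓ ![u, v] (Set.mem_univ_pi.mpr (Fin.forall_fin_two.mpr ⟨Set.Ioo_subset_Icc_self hu, hv⟩))
      simpa using this.ne'
    have hnum := (hasDerivAt_id' u).const_mul (-(x₂ - x₁))
    have hden := ((hasDerivAt_id' u).const_mul (x₁ + (x₂ - x₁) * v)).const_sub 1
    exact (hnum.fun_div hden hne).congr_deriv (by field_simp; ring)
  · have hne : 1 - (c + ε * (x₁ + (x₂ - x₁) * v)) * s * t ≠ 0 := by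
      have := dT ![s, t, v] (Set.mem_univ_pi.mpr ?_)
      · simpa using this.ne'
      · intro i; fin_cases i
        · simpa using hs
        · simpa using ht
        · simpa using Set.Ioo_subset_Icc_self hv
    have hx := (((hasDerivAt_id' v).const_mul (x₂ - x₁)).const_add x₁).const_mul ε |>.const_add c
    exact (hx.div (((hx.mul_const s).mul_const t).const_sub 1) hne).congr_deriv (by field_simp; ring)
  · have hne : 1 - (c + ε * (x₁ + (x₂ - x₁) * v)) * s * t ≠ 0 := by
      have := dT ![s, t, v] (Set.mem_univ_pi.mpr ?_)
      · simpa using this.ne'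
      · intro i; fin_cases i
        · simpa using hs
        · simpa using Set.Ioo_subset_Icc_self ht
        · simpa using hv
    have hnum := (hasDerivAt_id' t).const_mul (ε * (x₂ - x₁))
    have hden := ((hasDerivAt_id' t).const_mul ((c + ε * (x₁ + (x₂ - x₁) * v)) * s)).const_sub 1
    exact (hnum.fun_div hden (by simpa [mul_assoc] using hne)).congr_deriv (by field_simp; ring)

/-- (A6/A7) the triple log products `ℓ_w(x0)·λ(x1)·λ(x2)` with `ℓ_w(r,v) = −w/(1−wr)`, `w = c + εx(v)` (`κ = ℓ_{1−x}` for
`log x`, `λ = ℓ_x` for `log(1−x)`): PH3 with the closed-form primitives `μ_w(r,v) = −w′r/(1−wr)`, `w′ = ε(x₂−x₁)`.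
[cite: Zagier2007Dilogarithm, §I.2] -/
theorem trilog_termLogs (x₁ x₂ : ℝ) (h₁ : IsAlgebraic ℚ x₁) (h₂ : IsAlgebraic ℚ x₂)
    (h₁0 : 0 < x₁) (h₁1 : x₁ < 1) (h₂0 : 0 < x₂) (h₂1 : x₂ < 1) (ε c : ℝ) (hεc : (ε = 1 ∧ c = 0) ∨ (ε = -1 ∧ c = 1)) :
    FibStokesDecomposable 4 (fun x =>
      (-(ε * (x₂ - x₁)) * 1 / (1 - (c + ε * (x₁ + (x₂ - x₁) * x 3)) * 1)) *
              (-(x₁ + (x₂ - x₁) * x 3) / (1 - (x₁ + (x₂ - x₁) * x 3) * x 1)) *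
            (-(x₁ + (x₂ - x₁) * x 3) / (1 - (x₁ + (x₂ - x₁) * x 3) * x 2)) +
          (-(c + ε * (x₁ + (x₂ - x₁) * x 3)) / (1 - (c + ε * (x₁ + (x₂ - x₁) * x 3)) * x 0)) *
              (-(x₂ - x₁) * 1 / (1 - (x₁ + (x₂ - x₁) * x 3) * 1)) *
            (-(x₁ + (x₂ - x₁) * x 3) / (1 - (x₁ + (x₂ - x₁) * x 3) * x 2)) +
          (-(c + ε * (x₁ + (x₂ - x₁) * x 3)) / (1 - (c + ε * (x₁ + (x₂ - x₁) * x 3)) * x 0)) *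
              (-(x₁ + (x₂ - x₁) * x 3) / (1 - (x₁ + (x₂ - x₁) * x 3) * x 1)) *
            (-(x₂ - x₁) * 1 / (1 - (x₁ + (x₂ - x₁) * x 3) * 1)) -
        ((-(c + ε * (x₁ + (x₂ - x₁) * 1)) / (1 - (c + ε * (x₁ + (x₂ - x₁) * 1)) * x 0)) *
              (-(x₁ + (x₂ - x₁) * 1) / (1 - (x₁ + (x₂ - x₁) * 1) * x 1)) *
            (-(x₁ + (x₂ - x₁) * 1) / (1 - (x₁ + (x₂ - x₁) * 1) * x 2)) -
          (-(c + ε * (x₁ + (x₂ - x₁) * 0)) / (1 - (c + ε * (x₁ + (x₂ - x₁) * 0)) * x 0)) *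
              (-(x₁ + (x₂ - x₁) * 0) / (1 - (x₁ + (x₂ - x₁) * 0) * x 1)) *
            (-(x₁ + (x₂ - x₁) * 0) / (1 - (x₁ + (x₂ - x₁) * 0) * x 2)))) := by
  have hS2 : IsSemialgebraic ℚ (Set.pi Set.univ (fun _ : Fin 2 => Set.Icc (0:ℝ) 1)) := by
    rw [← cube_eq_pi]; exact isSemialgebraic_cube
  have hm2 : ∀ {z : Fin 2 → ℝ}, z ∈ Set.pi Set.univ (fun _ : Fin 2 => Set.Icc (0:ℝ) 1) → ∀ i, z i ∈ Set.Icc (0:ℝ) 1 :=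
    fun hz i => (Set.mem_univ_pi.mp hz) i
  have hεA : IsAlgebraic ℚ ε := by
    rcases hεc with ⟨rfl, -⟩ | ⟨rfl, -⟩
    · exact isAlgebraic_one
    · exact isAlgebraic_one.neg
  have hcA : IsAlgebraic ℚ c := by
    rcases hεc with ⟨-, rfl⟩ | ⟨-, rfl⟩
    · exact isAlgebraic_zero
    · exact isAlgebraic_one
  have hdA : IsAlgebraic ℚ (x₂ - x₁) := h₂.sub h₁
  have hw : ∀ v ∈ Set.Icc (0:ℝ) 1, 0 < c + ε * (x₁ + (x₂ - x₁) * v) ∧ c + ε * (x₁ + (x₂ - x₁) * v) < 1 := by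
    intro v hv
    have hx := trilog_path_mem h₁0 h₁1 h₂0 h₂1 v hv
    rcases hεc with ⟨rfl, rfl⟩ | ⟨rfl, rfl⟩
    · constructor <;> linarith [hx.1, hx.2]
    · constructor <;> linarith [hx.1, hx.2]
  have dL : ∀ z ∈ Set.pi Set.univ (fun _ : Fin 2 => Set.Icc (0:ℝ) 1), 0 < 1 - (x₁ + (x₂ - x₁) * z 1) * z 0 :=
    fun z hz => (trilog_den_pos h₁0 h₁1 h₂0 h₂1 (hm2 hz 1) (hm2 hz 0).2).1
  have dK : ∀ z ∈ Set.pi Set.univ (fun _ : Fin 2 => Set.Icc (0:ℝ) 1), 0 < 1 - (c + ε * (x₁ + (x₂ - x₁) * z 1)) * z 0 := by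
    intro z hz
    have h0 := hm2 hz 0
    have hwz := hw (z 1) (hm2 hz 1)
    nlinarith [mul_nonneg hwz.1.le h0.1, h0.2]
  have y : ∀ i, IsSemialgebraicFunOn ℚ (Set.pi Set.univ (fun _ : Fin 2 => Set.Icc (0:ℝ) 1)) (fun z => z i) :=
    fun i => isSemialgebraicFunOn_apply hS2 i
  have c2 : ∀ {t : ℝ}, IsAlgebraic ℚ t → IsSemialgebraicFunOn ℚ (Set.pi Set.univ (fun _ : Fin 2 => Set.Icc (0:ℝ) 1)) (fun _ => t) :=
    fun ht => isSemialgebraicFunOn_const_of_isAlgebraic hS2 ht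
  have sx2 := trilog_sa_path (n := 2) h₁ h₂ 1
  have sw2 : IsSemialgebraicFunOn ℚ (Set.pi Set.univ (fun _ : Fin 2 => Set.Icc (0:ℝ) 1))
      (fun z => c + ε * (x₁ + (x₂ - x₁) * z 1)) := (c2 hcA).fun_add ((c2 hεA).fun_mul sx2)
  have sDL : IsSemialgebraicFunOn ℚ (Set.pi Set.univ (fun _ : Fin 2 => Set.Icc (0:ℝ) 1))
      (fun z => 1 - (x₁ + (x₂ - x₁) * z 1) * z 0) := (c2 isAlgebraic_one).fun_sub (sx2.fun_mul (y 0))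
  have sDK : IsSemialgebraicFunOn ℚ (Set.pi Set.univ (fun _ : Fin 2 => Set.Icc (0:ℝ) 1))
      (fun z => 1 - (c + ε * (x₁ + (x₂ - x₁) * z 1)) * z 0) := (c2 isAlgebraic_one).fun_sub (sw2.fun_mul (y 0))
  -- the `λ` data (factors 2 and 3) and the `ℓ_w` data (factor 1)
  have Lsa := sx2.fun_neg.div sDL fun z hz => (dL z hz).ne'
  have Lvsa := (c2 hdA).fun_neg.div (sDL.fun_pow 2) fun z hz => pow_ne_zero 2 (dL z hz).ne'
  have Lμsa := (((c2 hdA).fun_neg).fun_mul (y 0)).div sDL fun z hz => (dL z hz).ne'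
  have Ksa := sw2.fun_neg.div sDK fun z hz => (dK z hz).ne'
  have Kvsa := ((c2 hεA).fun_mul (c2 hdA)).fun_neg.div (sDK.fun_pow 2) fun z hz => pow_ne_zero 2 (dK z hz).ne'
  have Kμsa := ((((c2 hεA).fun_mul (c2 hdA)).fun_neg).fun_mul (y 0)).div sDK fun z hz => (dK z hz).ne'
  have Lc : ContinuousOn (fun z : Fin 2 → ℝ => -(x₁ + (x₂ - x₁) * z 1) / (1 - (x₁ + (x₂ - x₁) * z 1) * z 0))
      (Set.pi Set.univ (fun _ : Fin 2 => Set.Icc (0:ℝ) 1)) :=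
    ContinuousOn.div (by fun_prop) (by fun_prop) fun z hz => (dL z hz).ne'
  have Lvc : ContinuousOn (fun z : Fin 2 → ℝ => -(x₂ - x₁) / (1 - (x₁ + (x₂ - x₁) * z 1) * z 0) ^ 2)
      (Set.pi Set.univ (fun _ : Fin 2 => Set.Icc (0:ℝ) 1)) :=
    ContinuousOn.div (by fun_prop) (by fun_prop) fun z hz => pow_ne_zero 2 (dL z hz).ne'
  have Lμc : ContinuousOn (fun z : Fin 2 → ℝ => -(x₂ - x₁) * z 0 / (1 - (x₁ + (x₂ - x₁) * z 1) * z 0))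
      (Set.pi Set.univ (fun _ : Fin 2 => Set.Icc (0:ℝ) 1)) :=
    ContinuousOn.div (by fun_prop) (by fun_prop) fun z hz => (dL z hz).ne'
  have Ldv : ∀ r ∈ Set.Icc (0:ℝ) 1, ∀ v ∈ Set.Ioo (0:ℝ) 1,
      HasDerivAt (fun q => -(x₁ + (x₂ - x₁) * q) / (1 - (x₁ + (x₂ - x₁) * q) * r))
        (-(x₂ - x₁) / (1 - (x₁ + (x₂ - x₁) * v) * r) ^ 2) v := by
    intro r hr v hv
    have hne : 1 - (x₁ + (x₂ - x₁) * v) * r ≠ 0 := by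
      have := dL ![r, v] (Set.mem_univ_pi.mpr (Fin.forall_fin_two.mpr ⟨hr, Set.Ioo_subset_Icc_self hv⟩))
      simpa using this.ne'
    have hx := ((hasDerivAt_id' v).const_mul (x₂ - x₁)).const_add x₁
    exact (hx.fun_neg.div ((hx.mul_const r).const_sub 1) hne).congr_deriv (by field_simp; ring)
  have Ldr : ∀ v ∈ Set.Icc (0:ℝ) 1, ∀ r ∈ Set.Ioo (0:ℝ) 1,
      HasDerivAt (fun q => -(x₂ - x₁) * q / (1 - (x₁ + (x₂ - x₁) * v) * q))
        (-(x₂ - x₁) / (1 - (x₁ + (x₂ - x₁) * v) * r) ^ 2) r := by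
    intro v hv r hr
    have hne : 1 - (x₁ + (x₂ - x₁) * v) * r ≠ 0 := by
      have := dL ![r, v] (Set.mem_univ_pi.mpr (Fin.forall_fin_two.mpr ⟨Set.Ioo_subset_Icc_self hr, hv⟩))
      simpa using this.ne'
    have hnum := (hasDerivAt_id' r).const_mul (-(x₂ - x₁))
    have hden := ((hasDerivAt_id' r).const_mul (x₁ + (x₂ - x₁) * v)).const_sub 1
    exact (hnum.fun_div hden hne).congr_deriv (by field_simp; ring)
  refine stub_logTripleProductHomotopy
    (fun r v => -(c + ε * (x₁ + (x₂ - x₁) * v)) / (1 - (c + ε * (x₁ + (x₂ - x₁) * v)) * r))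
    (fun r v => -(ε * (x₂ - x₁)) / (1 - (c + ε * (x₁ + (x₂ - x₁) * v)) * r) ^ 2)
    (fun r v => -(ε * (x₂ - x₁)) * r / (1 - (c + ε * (x₁ + (x₂ - x₁) * v)) * r))
    (fun r v => -(x₁ + (x₂ - x₁) * v) / (1 - (x₁ + (x₂ - x₁) * v) * r))
    (fun r v => -(x₂ - x₁) / (1 - (x₁ + (x₂ - x₁) * v) * r) ^ 2)
    (fun r v => -(x₂ - x₁) * r / (1 - (x₁ + (x₂ - x₁) * v) * r))
    (fun r v => -(x₁ + (x₂ - x₁) * v) / (1 - (x₁ + (x₂ - x₁) * v) * r))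
    (fun r v => -(x₂ - x₁) / (1 - (x₁ + (x₂ - x₁) * v) * r) ^ 2)
    (fun r v => -(x₂ - x₁) * r / (1 - (x₁ + (x₂ - x₁) * v) * r))
    Ksa Kvsa Kμsa Lsa Lvsa Lμsa Lsa Lvsa Lμsa
    (ContinuousOn.div (by fun_prop) (by fun_prop) fun z hz => (dK z hz).ne')
    (ContinuousOn.div (by fun_prop) (by fun_prop) fun z hz => pow_ne_zero 2 (dK z hz).ne')
    (ContinuousOn.div (by fun_prop) (by fun_prop) fun z hz => (dK z hz).ne')
    Lc Lvc Lμc Lc Lvc Lμc (fun r hr v hv => ?_) (fun v hv r hr => ?_) (fun v _ => by simp)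
    Ldv Ldr (fun v _ => by simp) Ldv Ldr (fun v _ => by simp)
  · have hne : 1 - (c + ε * (x₁ + (x₂ - x₁) * v)) * r ≠ 0 := by
      have := dK ![r, v] (Set.mem_univ_pi.mpr (Fin.forall_fin_two.mpr ⟨hr, Set.Ioo_subset_Icc_self hv⟩))
      simpa using this.ne'
    have hx := (((hasDerivAt_id' v).const_mul (x₂ - x₁)).const_add x₁).const_mul ε |>.const_add c
    exact (hx.fun_neg.div ((hx.mul_const r).const_sub 1) hne).congr_deriv (by field_simp; ring)
  · have hne : 1 - (c + ε * (x₁ + (x₂ - x₁) * v)) * r ≠ 0 := by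
      have := dK ![r, v] (Set.mem_univ_pi.mpr (Fin.forall_fin_two.mpr ⟨Set.Ioo_subset_Icc_self hr, hv⟩))
      simpa using this.ne'
    have hnum := (hasDerivAt_id' r).const_mul (-(ε * (x₂ - x₁)))
    have hden := ((hasDerivAt_id' r).const_mul (c + ε * (x₁ + (x₂ - x₁) * v))).const_sub 1
    exact (hnum.fun_div hden hne).congr_deriv (by field_simp; ring)


end Summit.KontsevichZagierPeriods.KontsevichZagierPeriods.Cruxes.StokesGeneration.FibrewiseStokes

end
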